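import Literature.NumberTheory.GaloisRepresentations.WeilDeligneOfGalois
import Literature.NumberTheory.GaloisRepresentations.WeilGroupFrobeniusPowers
import Literature.NumberTheory.GaloisRepresentations.WeilDeligneOfGaloisUnramifiedProofs
import Literature.NumberTheory.GaloisRepresentations.GaloisRep
import Literature.RepresentationTheory.Semisimple.BurnsideMatrixSpan
import Literature.LinearAlgebra.BaseChange.LinearIndependentFieldExtension
import Literature.LinearAlgebra.Matrix.NilpotentExpInjective
import Summits.Langlands.Langlands.Theorems.IrreducibilityBySelfDualityIrreducibleOffSectorWDIrreducibleBasics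
import HarnessLib

/-!
# L2: character rigidity — Weil-group traces of an irreducible Weil–Deligne representation
# force irreducibility
(crux stmt-Langlands-14329 `IrreducibilityBySelfDuality.IrreducibleOffSector`, supports kit
`square-integrable-place` §1; `--supports` file; STRUCTURAL: Literature imports only)

Over `ℂ`: if `S` is irreducible and `tr Wℂ.ρ(w) = tr S.ρ(w)` for all `w ∈ W_F`, then `Wℂ` is
irreducible.  Proof (no semisimplification needed): extend both to the group algebra `ℂ[W_F]`
(`MonoidAlgebra.lift`): `ψ = lift Wℂ.ρ`, `φ = lift S.ρ`, still `tr ∘ ψ = tr ∘ φ`; Burnside for `S`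
(`N = 0`, irreducible ⇒ `range φ = End(ℂⁿ)`); if `ψ a = 0` then `tr (φ a · φ b) = tr (ψ a · ψ b) = 0`
for all `b`, so `φ a = 0` by non-degeneracy of the trace form on `End(ℂⁿ) = range φ`
(`Matrix.ext_iff_trace_mul_left`); hence `ker ψ ≤ ker φ`, `φ` factors through `range ψ`, so
`n² = dim (range φ) ≤ dim (range ψ)`, `range ψ = End(ℂⁿ)` = the span of the `Wℂ.ρ w`, and `Wℂ` is
irreducible (`isIrreducible_of_span_toMatrix'_eq_top`).
Reference: Bourbaki, Algèbre VIII §20 n°6; Curtis–Reiner (27.4), (27.8).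
-/

noncomputable section

set_option linter.dupNamespace false

open scoped MatrixGroups Matrix NumberField
open Module IsDedekindDomain
open Literature.NumberTheory.GaloisRepresentations
open Literature.NumberTheory.GaloisRepresentations.WeilGroup

namespace Summit.Langlands.Langlands.Theorems.IrreducibleOffSector.SquareIntegrablePlace


/-- **L2 (character rigidity).** Over `ℂ`, a Weil–Deligne representation whose Weil-group traces
agree with those of an IRREDUCIBLE one on the same space is irreducible.
[cite: BourbakiAlgebreVIII2012, §20 n°6] -/
theorem isIrreducible_of_trace_eq {F : Type} [Field F] [ValuativeRel F]
    [TopologicalSpace F] [IsNonarchimedeanLocalField F] {n : ℕ}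
    (S Wℂ : WeilDeligneRep F ℂ (Fin n → ℂ)) (hS : S.IsIrreducible)
    (htr : ∀ w : WeilGroup F,
      LinearMap.trace ℂ (Fin n → ℂ) (Wℂ.ρ w) = LinearMap.trace ℂ (Fin n → ℂ) (S.ρ w)) :
    Wℂ.IsIrreducible := by
  classical
  have hn : 0 < n := pos_of_isIrreducible hS
  -- matrices of the two Weil-group representations
  set MS : WeilGroup F → Matrix (Fin n) (Fin n) ℂ := fun w => LinearMap.toMatrix' (S.ρ w) with hMS
  set MW : WeilGroup F → Matrix (Fin n) (Fin n) ℂ := fun w => LinearMap.toMatrix' (Wℂ.ρ w) with hMW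
  have hMSmul : ∀ w u, MS w * MS u = MS (w * u) := fun w u => by
    simp only [hMS, map_mul, LinearMap.toMatrix'_mul]
  have hMWmul : ∀ w u, MW w * MW u = MW (w * u) := fun w u => by
    simp only [hMW, map_mul, LinearMap.toMatrix'_mul]
  have htr' : ∀ w, (MW w).trace = (MS w).trace := fun w => by
    have h := htr w
    rw [LinearMap.trace_eq_matrix_trace ℂ (Pi.basisFun ℂ (Fin n)),
      LinearMap.trace_eq_matrix_trace ℂ (Pi.basisFun ℂ (Fin n))] at h
    simpa [LinearMap.toMatrix_eq_toMatrix'] using h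
  -- Burnside for the irreducible `S`: the `MS w` span `M_n(ℂ)`
  have hspanS : Submodule.span ℂ (Set.range MS) = ⊤ := span_toMatrix'_eq_top_of_isIrreducible hS
  -- paired linear combinations `∑ c_w MS w` and `∑ c_w MW w`
  set Φ : (WeilGroup F →₀ ℂ) →ₗ[ℂ] Matrix (Fin n) (Fin n) ℂ := Finsupp.linearCombination ℂ MS
    with hΦ
  set Ψ : (WeilGroup F →₀ ℂ) →ₗ[ℂ] Matrix (Fin n) (Fin n) ℂ := Finsupp.linearCombination ℂ MW
    with hΨ
  have hΦrange : LinearMap.range Φ = ⊤ := by rw [hΦ, Finsupp.range_linearCombination, hspanS]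
  have hΨrange : LinearMap.range Ψ = Submodule.span ℂ (Set.range MW) := by
    rw [hΨ, Finsupp.range_linearCombination]
  -- KEY: `∑ c_w MW w = 0 ⇒ ∑ c_w MS w = 0` (non-degeneracy of the trace form on `M_n(ℂ)`)
  have hkey : ∀ c, Ψ c = 0 → Φ c = 0 := by
    intro c hc
    have h1 : ∀ w, (MS w * Φ c).trace = 0 := by
      intro w
      have e1 : (MS w * Φ c).trace = c.sum (fun u a => a * (MS (w * u)).trace) := by
        simp only [hΦ, Finsupp.linearCombination_apply, Finsupp.sum]
        rw [Finset.mul_sum, Matrix.trace_sum]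
        refine Finset.sum_congr rfl fun u _ => ?_
        rw [Matrix.mul_smul, Matrix.trace_smul, hMSmul, smul_eq_mul]
      have e2 : (MW w * Ψ c).trace = c.sum (fun u a => a * (MW (w * u)).trace) := by
        simp only [hΨ, Finsupp.linearCombination_apply, Finsupp.sum]
        rw [Finset.mul_sum, Matrix.trace_sum]
        refine Finset.sum_congr rfl fun u _ => ?_
        rw [Matrix.mul_smul, Matrix.trace_smul, hMWmul, smul_eq_mul]
      rw [e1]
      simp_rw [← htr']
      rw [← e2, hc, mul_zero, Matrix.trace_zero]
    have h2 : ∀ X, (X * Φ c).trace = 0 := by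
      intro X
      have hX : X ∈ Submodule.span ℂ (Set.range MS) := by rw [hspanS]; exact Submodule.mem_top
      refine Submodule.span_induction (p := fun X _ => (X * Φ c).trace = 0) ?_ ?_ ?_ ?_ hX
      · rintro _ ⟨w, rfl⟩
        exact h1 w
      · rw [zero_mul, Matrix.trace_zero]
      · intro X Y _ _ hX hY
        rw [add_mul, Matrix.trace_add, hX, hY, add_zero]
      · intro a X _ hX
        rw [smul_mul_assoc, Matrix.trace_smul, hX, smul_zero]
    exact Matrix.ext_iff_trace_mul_left.mpr fun X => by rw [h2 X, mul_zero, Matrix.trace_zero]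
  -- hence `Φ` factors through `range Ψ`, so `dim (range Ψ) ≥ dim M_n(ℂ)`
  have hle : LinearMap.ker Ψ ≤ LinearMap.ker Φ := fun c hc => by
    rw [LinearMap.mem_ker] at hc ⊢
    exact hkey c hc
  set θ : LinearMap.range Ψ →ₗ[ℂ] Matrix (Fin n) (Fin n) ℂ :=
    ((LinearMap.ker Ψ).liftQ Φ hle) ∘ₗ
      (Ψ.quotKerEquivRange.symm : LinearMap.range Ψ →ₗ[ℂ] (WeilGroup F →₀ ℂ) ⧸ LinearMap.ker Ψ)
    with hθ
  have hθrange : LinearMap.range θ = ⊤ := by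
    rw [hθ, LinearMap.range_comp, LinearEquiv.range, Submodule.map_top, Submodule.range_liftQ,
      hΦrange]
  have hfin : Module.finrank ℂ (Matrix (Fin n) (Fin n) ℂ) ≤
      Module.finrank ℂ (LinearMap.range Ψ) := by
    calc Module.finrank ℂ (Matrix (Fin n) (Fin n) ℂ)
        = Module.finrank ℂ (LinearMap.range θ) := by rw [hθrange, finrank_top]
      _ ≤ Module.finrank ℂ (LinearMap.range Ψ) := LinearMap.finrank_range_le θ
  have hΨtop : LinearMap.range Ψ = ⊤ :=
    Submodule.eq_top_of_finrank_eq (le_antisymm (Submodule.finrank_le _) hfin)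
  rw [hΨrange] at hΨtop
  exact isIrreducible_of_span_toMatrix'_eq_top hn hΨtop

end Summit.Langlands.Langlands.Theorems.IrreducibleOffSector.SquareIntegrablePlace

end
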